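import Mathlib
import Summits.ResolutionOfSingularities.ResolutionOfSingularities.Theorems.HomologicalConductorNoZenoStableAnnihilatorReduction
import Summits.ResolutionOfSingularities.ResolutionOfSingularities.Theorems.HomologicalConductorPersistenceSurfaceHullCover
import Summits.ResolutionOfSingularities.ResolutionOfSingularities.Theorems.HomologicalConductorPersistenceInvolutionTransfer
import HarnessLib

/-!
# Crux `Persistence` (stmt-16484) / rung S-2 `PersistenceSurface` (stmt-19970) — the CYCLIC (μ₃) TRANSFER lemma
# for stable annihilators along `U = V^σ`, `σ³ = 1` (chain W4.4b, seat res-L1-w44b-stub-4 gen 3, memo SIGMA6b §6)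

[OURS · L1 w44b · Σ6] Nothing here is a statement of the manuscript under review (Hironaka 2017); AI-written,
weaker than expert review.  Companion of `…PersistenceInvolutionTransfer` (p510111, the case `σ² = 1`).

SETTING. `σ : V →ₐ[U] V` with `σ³ = 1`, fixed ring `U` (`algebraMap` injective onto the fixed points), a primitive
cube root of unity `ω ∈ U` (`ω² + ω + 1 = 0`) and `3 ∈ Uˣ`; `τ : M →+ M` a `σ`-semilinear automorphism of order 3 of
a `V`-module `M`, `j : N ↪ M` the `U`-module of `τ`-invariants.  This is the algebra of `Spec V → Spec V/μ₃`; in the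
W4.4b census it is the x-chart of the blow-up of `Ẽ₇ = {x² + y⁴ + z⁴}` along `ca = (x) + (y,z)³`:
`U_x(Ẽ₇) = Ẽ₇^{⅓(1,1,2)}` (cone over an elliptic normal sextic), with `x = w³`, `σ w = ω² w`, and `w ∈ jac(Ẽ₇)`.

RESULTS.
* `exists_comp_eq_smul_id_fixed_of_equivariant₃` — the core restriction lemma of p510111 with THREE equivariant
  free factorisation summands `G₁F₁ + G₂F₂ + G₃F₃ = w • id_M`.
* `exists_comp_eq_smul_id_fixed_of_cube` — CYCLIC TRANSFER (free form): a free `V`-factorisation `g ∘ f = c • id_M`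
  with `σ c = ω² c`, and `a, b` with `σ a = ω² a`, `σ b = ω² b`, give a free `U`-factorisation of `u • id_N` for
  `algebraMap u = a * b * c`.  Proof: with the conjugates `f⁽¹⁾ = σ_F f τ²`, `f⁽²⁾ = σ_F² f τ`, `g⁽¹⁾ = τ g σ_F²`,
  `g⁽²⁾ = τ² g σ_F` (so `g⁽ᵏ⁾ f⁽ᵏ⁾ = σᵏ(c) • id`) and the character components `F_j = f + ω^{2j} f⁽¹⁾ + ω^{j} f⁽²⁾`,
  `G_l = g + ω^{2l} g⁽¹⁾ + ω^{l} g⁽²⁾`, one has `G₀F₂ + G₁F₁ + G₂F₀ = 9c • id` (cross terms cancel by `1 + ω + ω² = 0`),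
  and `ab G₀F₂ + (aG₁)(bF₁) + (abG₂)F₀` is a sum of three EQUIVARIANT factorisations; divide by `9 ∈ Uˣ`.
  (The character-`ω` case is the same statement with `ω` replaced by `ω²`.)
* `StablyAnnihilates.fixed_of_cube` — CA-layer form: `StablyAnnihilates V c M → StablyAnnihilates U u N`.

APPLICATION (memo SIGMA6b §6; inputs not formalised: `jac ⊆ ca` for the hypersurface `Ẽ₇` — differentiate a
matrix factorisation —, and Auslander's reflexive correspondence `MCM(U) = MCM(Ẽ₇)^{μ₃}`): with `c = a = b = w`,
`x = w³ ∈ ca(U_x(Ẽ₇))`, i.e. exponent-one Persistence HOLDS at the first step of the `Ẽ₇` tower although the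
Jacobian pre-test fails there (`J(U) ⊆ 𝔪⁴ ∌ x`); with `a, b ∈ {w, u², uv, v²}` one gets `(y,z)·𝔪 ⊆ ca(U)`.

Reference: Iyengar–Takahashi, IMRN 2016, arXiv:1404.1476, Remark 2.13 [`IyengarTakahashi2014`]; the isotypic
split is the Reynolds projector for `μ₃` (folklore).
-/

-- single-problem summit: the doubled namespace component `ResolutionOfSingularities` is forced
set_option linter.dupNamespace false

noncomputable section

open CategoryTheory Literature.RingTheory.CohomologyAnnihilator
open Summit.ResolutionOfSingularities.ResolutionOfSingularities.Theorems.NoZeno.SandwichCluster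
open Summit.ResolutionOfSingularities.ResolutionOfSingularities.Theorems.HomologicalConductor.PersistenceSurfaceHullCover
open Summit.ResolutionOfSingularities.ResolutionOfSingularities.Theorems.HomologicalConductor.PersistenceInvolutionTransfer

universe u

namespace Summit.ResolutionOfSingularities.ResolutionOfSingularities.Theorems.HomologicalConductor.PersistenceCyclicTransfer

variable {U V : Type u} [CommRing U] [CommRing V] [Algebra U V]
variable {M : Type u} [AddCommGroup M] [Module V M] [Module U M] [IsScalarTower U V M]
variable {N : Type u} [AddCommGroup N] [Module U N]

/-- Two free factorisation summands `β₁ ∘ α₁ + β₂ ∘ α₂` are ONE composite `β ∘ α` through `Fin (s + t) → C`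
(no condition on the sum; cf. `exists_comp_eq_smul_id_of_add`). [folklore] -/
theorem exists_comp_eq_comp_add_comp {C : Type u} [CommRing C] {X : Type u} [AddCommGroup X] [Module C X]
    {s t : ℕ} (α₁ : X →ₗ[C] (Fin s → C)) (β₁ : (Fin s → C) →ₗ[C] X) (α₂ : X →ₗ[C] (Fin t → C))
    (β₂ : (Fin t → C) →ₗ[C] X) :
    ∃ (α : X →ₗ[C] (Fin (s + t) → C)) (β : (Fin (s + t) → C) →ₗ[C] X), β ∘ₗ α = β₁ ∘ₗ α₁ + β₂ ∘ₗ α₂ := by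
  let e : ((Fin s → C) × (Fin t → C)) ≃ₗ[C] (Fin (s + t) → C) :=
    (LinearEquiv.sumArrowLequivProdArrow (Fin s) (Fin t) C C).symm ≪≫ₗ
      (LinearEquiv.funCongrLeft C C finSumFinEquiv.symm)
  refine ⟨e.toLinearMap ∘ₗ (α₁.prod α₂), (β₁.coprod β₂) ∘ₗ e.symm.toLinearMap, ?_⟩
  calc (β₁.coprod β₂ ∘ₗ e.symm.toLinearMap) ∘ₗ (e.toLinearMap ∘ₗ α₁.prod α₂)
      = β₁.coprod β₂ ∘ₗ ((e.symm.toLinearMap ∘ₗ e.toLinearMap) ∘ₗ α₁.prod α₂) := by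
        simp only [LinearMap.comp_assoc]
    _ = β₁.coprod β₂ ∘ₗ α₁.prod α₂ := by
        rw [LinearEquiv.symm_comp, LinearMap.id_comp]
    _ = β₁ ∘ₗ α₁ + β₂ ∘ₗ α₂ := by rw [LinearMap.coprod_comp_prod]

/-! ## The core with three summands -/

/-- **Core restriction lemma, three summands** (cf. `exists_comp_eq_smul_id_fixed_of_equivariant`): equivariant
`V`-linear `F_i : M → Vˢ`, `G_i : Vˢ → M` (`i = 1,2,3`) with `Σ G_i (F_i m) = w • m` and `algebraMap u = w` give a free
`U`-factorisation of `u • id_N` on the invariants. [folklore] -/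
theorem exists_comp_eq_smul_id_fixed_of_equivariant₃ (σ : V →ₐ[U] V)
    (hfix : ∀ v : V, σ v = v → ∃ u : U, algebraMap U V u = v) (hinj : Function.Injective (algebraMap U V))
    (τ : M →+ M) (j : N →ₗ[U] M) (hjinj : Function.Injective j) (hjτ : ∀ n, τ (j n) = j n)
    (hjsurj : ∀ m, τ m = m → ∃ n, j n = m) {s : ℕ} (F₁ F₂ F₃ : M →ₗ[V] (Fin s → V))
    (G₁ G₂ G₃ : (Fin s → V) →ₗ[V] M) (hF₁ : ∀ m i, F₁ (τ m) i = σ (F₁ m i))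
    (hF₂ : ∀ m i, F₂ (τ m) i = σ (F₂ m i)) (hF₃ : ∀ m i, F₃ (τ m) i = σ (F₃ m i))
    (hG₁ : ∀ x, τ (G₁ x) = G₁ (fun i => σ (x i))) (hG₂ : ∀ x, τ (G₂ x) = G₂ (fun i => σ (x i)))
    (hG₃ : ∀ x, τ (G₃ x) = G₃ (fun i => σ (x i))) {w : V}
    (hsum : ∀ m, G₁ (F₁ m) + G₂ (F₂ m) + G₃ (F₃ m) = w • m) (u : U) (hu : algebraMap U V u = w) :
    ∃ (t : ℕ) (f' : N →ₗ[U] (Fin t → U)) (g' : (Fin t → U) →ₗ[U] N), g' ∘ₗ f' = u • LinearMap.id := by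
  classical
  choose φ hφ using hfix
  choose ρ hρ using hjsurj
  have hGfix : ∀ (G : (Fin s → V) →ₗ[V] M), (∀ x, τ (G x) = G (fun i => σ (x i))) →
      ∀ x : Fin s → U, τ (G (fun i => algebraMap U V (x i))) = G (fun i => algebraMap U V (x i)) := by
    intro G hG x
    rw [hG]
    simp only [AlgHom.commutes]
  have hι : ∀ (x y : Fin s → U), (fun i => algebraMap U V ((x + y) i)) =
      (fun i => algebraMap U V (x i)) + (fun i => algebraMap U V (y i)) := fun x y => by
    funext i; simp
  have hιs : ∀ (c : U) (x : Fin s → U), (fun i => algebraMap U V ((c • x) i)) =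
      algebraMap U V c • (fun i => algebraMap U V (x i)) := fun c x => by
    funext i; simp
  -- restriction of an equivariant pair
  have restr : ∀ (F : M →ₗ[V] (Fin s → V)) (G : (Fin s → V) →ₗ[V] M),
      (∀ m i, F (τ m) i = σ (F m i)) → (∀ x, τ (G x) = G (fun i => σ (x i))) →
      ∃ (f : N →ₗ[U] (Fin s → U)) (g : (Fin s → U) →ₗ[U] N), ∀ n, j (g (f n)) = G (F (j n)) := by
    intro F G hF hG
    have hFfix : ∀ n i, σ (F (j n) i) = F (j n) i := fun n i => by rw [← hF, hjτ]
    let f : N →ₗ[U] (Fin s → U) :=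
      { toFun := fun n i => φ (F (j n) i) (hFfix n i)
        map_add' := fun n n' => by
          funext i
          apply hinj
          simp only [Pi.add_apply, map_add, hφ]
        map_smul' := fun c n => by
          funext i
          apply hinj
          simp only [Pi.smul_apply, smul_eq_mul, map_mul, RingHom.id_apply, hφ, LinearMap.map_smul_of_tower]
          exact Algebra.smul_def c _ }
    let g : (Fin s → U) →ₗ[U] N :=
      { toFun := fun x => ρ (G (fun i => algebraMap U V (x i))) (hGfix G hG x)
        map_add' := fun x y => by
          apply hjinj
          rw [map_add, hρ, hρ, hρ, hι, map_add]
        map_smul' := fun c x => by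
          apply hjinj
          rw [LinearMap.map_smul_of_tower, hρ, hρ, RingHom.id_apply, hιs, map_smul, algebraMap_smul] }
    refine ⟨f, g, fun n => ?_⟩
    have hf : (fun i => algebraMap U V (f n i)) = F (j n) := by funext i; exact hφ _ _
    change j (ρ _ _) = _
    rw [hρ, hf]
  obtain ⟨f₁, g₁, h₁⟩ := restr F₁ G₁ hF₁ hG₁
  obtain ⟨f₂, g₂, h₂⟩ := restr F₂ G₂ hF₂ hG₂
  obtain ⟨f₃, g₃, h₃⟩ := restr F₃ G₃ hF₃ hG₃
  have h12 : (g₁ ∘ₗ f₁ + g₂ ∘ₗ f₂) + g₃ ∘ₗ f₃ = u • LinearMap.id := by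
    apply LinearMap.ext
    intro n
    apply hjinj
    simp only [LinearMap.add_apply, LinearMap.comp_apply, LinearMap.smul_apply, LinearMap.id_apply, map_add,
      LinearMap.map_smul_of_tower, h₁, h₂, h₃, hsum, ← hu, algebraMap_smul]
  obtain ⟨α, β, hαβ⟩ := exists_comp_eq_comp_add_comp f₁ g₁ f₂ g₂
  -- `β ∘ α = g₁f₁ + g₂f₂`; combine with the third pair
  have h123 : β ∘ₗ α + g₃ ∘ₗ f₃ = u • LinearMap.id := by rw [hαβ]; exact h12
  obtain ⟨α', β', h'⟩ := exists_comp_eq_smul_id_of_add α β f₃ g₃ h123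
  exact ⟨_, α', β', h'⟩

/-! ## The μ₃ character split -/

/-- **Cyclic (μ₃) transfer, free form.** `σ³ = 1` on `V` with fixed ring `U`, `ω ∈ U` a primitive cube root of unity,
`3 ∈ Uˣ`; `τ` a `σ`-semilinear automorphism of `M` of order `3`, `N = M^τ`.  A free `V`-factorisation `g ∘ f = c • id_M`
with `σ c = ω² c`, and scalars `a, b` with `σ a = ω² a`, `σ b = ω² b`, give a free `U`-factorisation of `u • id_N`
whenever `algebraMap U V u = a * b * c`. [folklore] -/
theorem exists_comp_eq_smul_id_fixed_of_cube (σ : V →ₐ[U] V) (hσ3 : ∀ v, σ (σ (σ v)) = v)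
    (hfix : ∀ v : V, σ v = v → ∃ u : U, algebraMap U V u = v) (hinj : Function.Injective (algebraMap U V))
    (ω : U) (hω : ω ^ 2 + ω + 1 = 0) (h3 : IsUnit (3 : U)) (τ : M →+ M)
    (hτ : ∀ (v : V) (m : M), τ (v • m) = σ v • τ m) (hτ3 : ∀ m, τ (τ (τ m)) = m) (j : N →ₗ[U] M)
    (hjinj : Function.Injective j) (hjτ : ∀ n, τ (j n) = j n) (hjsurj : ∀ m, τ m = m → ∃ n, j n = m)
    {c a b : V} (hc : σ c = algebraMap U V (ω ^ 2) * c) (ha : σ a = algebraMap U V (ω ^ 2) * a)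
    (hb : σ b = algebraMap U V (ω ^ 2) * b) {s : ℕ} (f : M →ₗ[V] (Fin s → V)) (g : (Fin s → V) →ₗ[V] M)
    (hgf : g ∘ₗ f = c • LinearMap.id) (u : U) (hu : algebraMap U V u = a * b * c) :
    ∃ (t : ℕ) (f' : N →ₗ[U] (Fin t → U)) (g' : (Fin t → U) →ₗ[U] N), g' ∘ₗ f' = u • LinearMap.id := by
  -- the cube root of unity in `V`
  set η : V := algebraMap U V ω with hηdef
  have hη : η ^ 2 + η + 1 = 0 := by
    have := congrArg (algebraMap U V) hω
    simpa [hηdef] using this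
  have hη3 : η ^ 3 = 1 := by linear_combination (η - 1) * hη
  have hση : σ η = η := by rw [hηdef]; exact AlgHom.commutes σ ω
  have hση2 : σ (η ^ 2) = η ^ 2 := by rw [map_pow, hση]
  have hc' : σ c = η ^ 2 * c := by rw [hc, map_pow]
  have ha' : σ a = η ^ 2 * a := by rw [ha, map_pow]
  have hb' : σ b = η ^ 2 * b := by rw [hb, map_pow]
  -- coordinatewise action on the free module and its iterates
  let sF : (Fin s → V) → (Fin s → V) := fun x i => σ (x i)
  have sF_add : ∀ x y, sF (x + y) = sF x + sF y := fun x y => by funext i; simp [sF]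
  have sF_smul : ∀ (v : V) x, sF (v • x) = σ v • sF x := fun v x => by funext i; simp [sF]
  have sF3 : ∀ x, sF (sF (sF x)) = x := fun x => by funext i; simp [sF, hσ3]
  have hτ2 : ∀ (v : V) (m : M), τ (τ (v • m)) = σ (σ v) • τ (τ m) := fun v m => by rw [hτ, hτ]
  -- the conjugates f⁽¹⁾ = σ_F f τ², f⁽²⁾ = σ_F² f τ, g⁽¹⁾ = τ g σ_F², g⁽²⁾ = τ² g σ_F
  let f1 : M →ₗ[V] (Fin s → V) :=
    { toFun := fun m => sF (f (τ (τ m)))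
      map_add' := fun m m' => by simp only [map_add, sF_add]
      map_smul' := fun v m => by
        rw [hτ2, map_smul, sF_smul, hσ3, RingHom.id_apply] }
  let f2 : M →ₗ[V] (Fin s → V) :=
    { toFun := fun m => sF (sF (f (τ m)))
      map_add' := fun m m' => by simp only [map_add, sF_add]
      map_smul' := fun v m => by
        rw [hτ, map_smul, sF_smul, sF_smul, hσ3, RingHom.id_apply] }
  let g1 : (Fin s → V) →ₗ[V] M :=
    { toFun := fun x => τ (g (sF (sF x)))
      map_add' := fun x y => by simp only [sF_add, map_add]
      map_smul' := fun v x => by rw [sF_smul, sF_smul, map_smul, hτ, hσ3, RingHom.id_apply] }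
  let g2 : (Fin s → V) →ₗ[V] M :=
    { toFun := fun x => τ (τ (g (sF x)))
      map_add' := fun x y => by simp only [sF_add, map_add]
      map_smul' := fun v x => by rw [sF_smul, map_smul, hτ2, hσ3, RingHom.id_apply] }
  have hgf' : ∀ m, g (f m) = c • m := fun m => by simpa using LinearMap.congr_fun hgf m
  have hf1 : ∀ m, f1 m = sF (f (τ (τ m))) := fun m => rfl
  have hf2 : ∀ m, f2 m = sF (sF (f (τ m))) := fun m => rfl
  have hg1 : ∀ x, g1 x = τ (g (sF (sF x))) := fun x => rfl
  have hg2 : ∀ x, g2 x = τ (τ (g (sF x))) := fun x => rfl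
  -- diagonal identities g⁽ᵏ⁾ f⁽ᵏ⁾ = σᵏ(c) • id
  have hd1 : ∀ m, g1 (f1 m) = (η ^ 2 * c) • m := fun m => by
    rw [hf1, hg1, sF3, hgf', hτ, hτ3, hc']
  have hd2 : ∀ m, g2 (f2 m) = (η * c) • m := fun m => by
    rw [hf2, hg2, sF3, hgf', hτ2, hc', map_mul, hση2, hc']
    have : τ (τ (τ m)) = m := hτ3 m
    rw [this]
    congr 1
    linear_combination (η * c) * hη3
  -- the character components (scaled by 3): F_j = f + η^{2j} f⁽¹⁾ + η^{j} f⁽²⁾, G_l = g + η^{2l} g⁽¹⁾ + η^{l} g⁽²⁾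
  let F0 : M →ₗ[V] (Fin s → V) := f + f1 + f2
  let F1 : M →ₗ[V] (Fin s → V) := f + (η ^ 2) • f1 + η • f2
  let F2 : M →ₗ[V] (Fin s → V) := f + η • f1 + (η ^ 2) • f2
  let G0 : (Fin s → V) →ₗ[V] M := g + g1 + g2
  let G1 : (Fin s → V) →ₗ[V] M := g + (η ^ 2) • g1 + η • g2
  let G2 : (Fin s → V) →ₗ[V] M := g + η • g1 + (η ^ 2) • g2
  -- the three equivariant pairs: (abG₂, F₀), (aG₁, bF₁), (G₀, abF₂)
  let P₁ : M →ₗ[V] (Fin s → V) := F0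
  let Q₁ : (Fin s → V) →ₗ[V] M := (a * b) • G2
  let P₂ : M →ₗ[V] (Fin s → V) := b • F1
  let Q₂ : (Fin s → V) →ₗ[V] M := a • G1
  let P₃ : M →ₗ[V] (Fin s → V) := (a * b) • F2
  let Q₃ : (Fin s → V) →ₗ[V] M := G0
  -- cross terms: name the nine products
  have hsum : ∀ m, Q₁ (P₁ m) + Q₂ (P₂ m) + Q₃ (P₃ m) = (9 * (a * b * c)) • m := by
    intro m
    -- abbreviations for the cross terms
    have e00 : g (f m) = c • m := hgf' m
    simp only [P₁, Q₁, P₂, Q₂, P₃, Q₃, F0, F1, F2, G0, G1, G2, LinearMap.smul_apply, LinearMap.add_apply, map_add,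
      map_smul, smul_add, e00, hd1, hd2, smul_smul]
    -- remaining atoms: g (f1 m), g (f2 m), g1 (f m), g1 (f2 m), g2 (f m), g2 (f1 m), and m
    match_scalars <;>
      first
        | linear_combination (a * b) * hη
        | linear_combination (a * b) * hη + (a * b) * hη3
        | linear_combination (a * b * c * (η ^ 3 + 6)) * hη3
  -- equivariance of the three pairs
  have hP₁ : ∀ m i, P₁ (τ m) i = σ (P₁ m i) := by
    intro m i
    simp only [P₁, F0, LinearMap.add_apply, Pi.add_apply, hf1, hf2, sF, hτ3, map_add, hσ3]
    ring
  have hP₂ : ∀ m i, P₂ (τ m) i = σ (P₂ m i) := by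
    intro m i
    simp only [P₂, F1, LinearMap.smul_apply, LinearMap.add_apply, Pi.smul_apply, Pi.add_apply, smul_eq_mul, hf1,
      hf2, sF, hτ3, map_add, map_mul, map_pow, hσ3, hση, hb']
    linear_combination (-(b * f (τ m) i + b * η * σ (σ (f (τ (τ m)) i)))) * hη3
  have hP₃ : ∀ m i, P₃ (τ m) i = σ (P₃ m i) := by
    intro m i
    simp only [P₃, F2, LinearMap.smul_apply, LinearMap.add_apply, Pi.smul_apply, Pi.add_apply, smul_eq_mul, hf1,
      hf2, sF, hτ3, map_add, map_mul, map_pow, hσ3, hση, ha', hb']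
    linear_combination (-(a * b * (η ^ 3 + 1) * f (τ m) i + a * b * η * σ (f m i) +
      a * b * η ^ 2 * σ (σ (f (τ (τ m)) i)))) * hη3
  have hτg : ∀ x, τ (g x) = g1 (sF x) := fun x => by rw [hg1, sF3]
  have hτg1 : ∀ x, τ (g1 x) = g2 (sF x) := fun x => by rw [hg1, hg2]
  have hτg2 : ∀ x, τ (g2 x) = g (sF x) := fun x => by rw [hg2, hτ3]
  have hQ₁ : ∀ x, τ (Q₁ x) = Q₁ (fun i => σ (x i)) := by
    intro x
    change τ (Q₁ x) = Q₁ (sF x)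
    simp only [Q₁, G2, LinearMap.smul_apply, LinearMap.add_apply, hτ, map_add, smul_add, hτg, hτg1, hτg2, map_mul,
      map_pow, hση, ha', hb', smul_smul]
    match_scalars <;>
      first
        | ring1
        | linear_combination (a * b * η) * hη3
        | linear_combination (a * b * η ^ 2) * hη3
        | linear_combination (a * b * (η ^ 3 + 1)) * hη3
  have hQ₂ : ∀ x, τ (Q₂ x) = Q₂ (fun i => σ (x i)) := by
    intro x
    change τ (Q₂ x) = Q₂ (sF x)
    simp only [Q₂, G1, LinearMap.smul_apply, LinearMap.add_apply, hτ, map_add, smul_add, hτg, hτg1, hτg2, map_mul,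
      hση, map_pow, ha', smul_smul]
    match_scalars <;>
      first
        | ring1
        | linear_combination a * hη3
        | linear_combination (a * η) * hη3
  have hQ₃ : ∀ x, τ (Q₃ x) = Q₃ (fun i => σ (x i)) := by
    intro x
    change τ (Q₃ x) = Q₃ (sF x)
    simp only [Q₃, G0, LinearMap.add_apply, map_add, hτg, hτg1, hτg2]
    abel
  -- `9u ↦ 9abc`; restrict to invariants, then divide by the unit `9`
  have hu9 : algebraMap U V (9 * u) = 9 * (a * b * c) := by rw [map_mul, hu, map_ofNat]
  obtain ⟨t, f', g', h⟩ := exists_comp_eq_smul_id_fixed_of_equivariant₃ σ hfix hinj τ j hjinj hjτ hjsurj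
    P₁ P₂ P₃ Q₁ Q₂ Q₃ hP₁ hP₂ hP₃ hQ₁ hQ₂ hQ₃ hsum (9 * u) hu9
  have h9 : IsUnit (9 : U) := by
    have : (9 : U) = 3 * 3 := by norm_num
    rw [this]; exact h3.mul h3
  obtain ⟨w9, hw9⟩ := h9
  refine ⟨t, (↑w9⁻¹ : U) • f', g', ?_⟩
  rw [LinearMap.comp_smul, h, smul_smul]
  congr 1
  rw [← hw9, Units.inv_mul_cancel_left]

/-- **Cyclic (μ₃) transfer, CA-layer form**: `c` stably annihilates the `V`-module `M`, `σ c = ω² c`, `σ a = ω² a`,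
`σ b = ω² b`, `algebraMap U V u = a * b * c` ⟹ `u` stably annihilates the invariant `U`-module `N ≅ M^τ`.  With
`a = b = c = w ∈ jac(Ẽ₇)` this is `x = w³ ∈ s̲ann_U(N)` for every MCM `N = M^{μ₃}` over `U = U_x(Ẽ₇)` (memo SIGMA6b §6).
[folklore] -/
theorem StablyAnnihilates.fixed_of_cube (σ : V →ₐ[U] V) (hσ3 : ∀ v, σ (σ (σ v)) = v)
    (hfix : ∀ v : V, σ v = v → ∃ u : U, algebraMap U V u = v) (hinj : Function.Injective (algebraMap U V))
    (ω : U) (hω : ω ^ 2 + ω + 1 = 0) (h3 : IsUnit (3 : U)) (τ : M →+ M)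
    (hτ : ∀ (v : V) (m : M), τ (v • m) = σ v • τ m) (hτ3 : ∀ m, τ (τ (τ m)) = m) (j : N →ₗ[U] M)
    (hjinj : Function.Injective j) (hjτ : ∀ n, τ (j n) = j n) (hjsurj : ∀ m, τ m = m → ∃ n, j n = m)
    {c a b : V} (hc : σ c = algebraMap U V (ω ^ 2) * c) (ha : σ a = algebraMap U V (ω ^ 2) * a)
    (hb : σ b = algebraMap U V (ω ^ 2) * b) (h : StablyAnnihilates V c (ModuleCat.of V M)) (u : U)
    (hu : algebraMap U V u = a * b * c) : StablyAnnihilates U u (ModuleCat.of U N) := by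
  obtain ⟨s, f, g, hgf⟩ := (stablyAnnihilates_iff_exists_linearMap c (ModuleCat.of V M)).mp h
  obtain ⟨t, f', g', h'⟩ := exists_comp_eq_smul_id_fixed_of_cube σ hσ3 hfix hinj ω hω h3 τ hτ hτ3 j hjinj hjτ
    hjsurj hc ha hb f g hgf u hu
  exact stablyAnnihilates_of_linearMap f' g' h'

end Summit.ResolutionOfSingularities.ResolutionOfSingularities.Theorems.HomologicalConductor.PersistenceCyclicTransfer
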